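import Literature.AnabelianGeometry.EtaleTheta.Discharge.Sec3Thm37Units
import Literature.AlgebraicGeometry.Frobenioids.PadicUnitGroupProfinite
import HarnessLib

/-!
# [EtTh] Theorem 3.7 (i) «unit-profinite type (Λ = ℤ)» from Proposition 3.4 (ii), and (iv) for Λ = ℤ

Proof-only sequel (theorems only, no definitions) of `Discharge/Sec3Thm37Units.lean` (abc-iut-w5-d164) for
row `EtTh:Thm3.7(i)/L06` (+ `EtTh:Thm3.7(iv)/L00Z`) of `plan/L2/SUBDAG-EtTh-Thm37.md`.  S. Mochizuki,
*The étale theta function …*, Publ. RIMS **45** (2009) [EtTh], §3, Thm. 3.7 (i), p. 305, proof p. 306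
ll. 4–6 (PDF pp. 79–80 of `paper:doi-10-2977-prims-1234361159`):

> "By Proposition 3.4, (ii) … it follows that if, moreover, `Λ = ℤ` …, then `C` is of unit-profinite …
> type",

Proposition 3.4 (ii) (p. 300) being "`O_L^× ⥲ Ker(B₀(Y^log) → Φ₀^gp(Y^log)) ⊆ B₀(Y^log)` … — where `O_L`
… is as in [FrdII], Example 1.1" for `Y^log` geometrically connected over the finite extension `L` of
`K` (a finite extension of `ℚ_p`).  abc-iut-L2-t3's typed `DivisorMonoids.Prop34` records this isomorphism
only as "kernel ⊆ constants", so here it enters BY NAME, in the tree's vocabulary, as the hypothesis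
`hP34`: for every object `A` of `D`, the kernel of `B₀^Λ(Y_A)^× → (Φ₀^ℝ)^gp(Y_A)` is isomorphic to the unit
group `O_L^×` (`PadicFrd.unitSubgroup L`) of some finite extension `L` of `ℚ_p` (abc-iut-L1-t4's `PadicFld p`
with `IsPadicLocal`).  Given that, "`C` is of unit-profinite type" ([FrdI] Def 2.8 (i), L1's REAL predicate
`PreFrobenioid.IsOfUnitProfiniteType`) follows from abc-iut-L1-d10's PROVED local-field fact
`PadicFrd.PadicFld.admitsTfgProfiniteTopology_unitSubgroup` ([FrdII] Thm 1.2 (i): `O_L^×` is a topologically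
finitely generated profinite group) and `Sec3Thm37Units`' `O^×(A) ≅ Ker(B₀^Λ(Y_A)^× → (Φ₀^ℝ)^gp(Y_A))`
(`isOfUnitProfiniteType_of_kerIsoPadicUnits`); whence Thm 3.7 (iv) for such data
(`thm37_iv_of_kerIsoPadicUnits`) and the two unit conjuncts of L2-t3's `Thm37_i` in REAL vocabulary for
`Λ = ℤ` data.  HONEST FRAMING: refereed pre-IUT material; nothing here bears on [IUTchIII] Cor. 3.12; the
hypothesis `hP34` is a printed input (Prop. 3.4 (ii)), not a new fact — it is discharged by any
instantiation of the Def. 3.3/3.6 data from actual tempered coverings of a once-punctured elliptic curve.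
-/

namespace Literature.AnabelianGeometry.EtaleTheta

open CategoryTheory Opposite Literature.AlgebraicGeometry.Frobenioids

universe u₀ v₀ u v w uK

namespace TemperedFrobenioid

variable {D₀ : Type u₀} [Category.{v₀} D₀] {V : FrdIMonoidStub.{w}}
  {T : RealifiedDivisorMonoids (D₀ := D₀) V} {D : Type u} [Category.{v} D]
  {VD : FrdICatStub.{u, v, w} D} (C₀ : TemperedFrobenioid T D VD) {p : ℕ} [Fact p.Prime]

/-- **(L06) [EtTh] Thm 3.7 (i), "`C` is of unit-profinite type" (the case `Λ = ℤ`), from Proposition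
3.4 (ii).**  If for every object `A` of `D` the kernel of `B₀^Λ(Y_A)^× → (Φ₀^ℝ)^gp(Y_A)` is isomorphic to the
unit group `O_L^×` of a finite extension `L` of `ℚ_p` (Prop. 3.4 (ii), first isomorphism, BY NAME), then the
tempered Frobenioid is of unit-profinite type in the sense of [FrdI] Def 2.8 (i) (L1's REAL predicate):
`O^×(A) ≅ Ker ≅ O_L^×` and `O_L^×` is a topologically finitely generated profinite group ([FrdII] Thm 1.2
(i), PROVED by abc-iut-L1-d10).  Modulo `hF` ([FrdI] Thm 5.2 (ii)). [cite: MochizukiEtTh2009, Thm 3.7 p.79] -/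
theorem isOfUnitProfiniteType_of_kerIsoPadicUnits (hF : PreFrobenioid.IsFrobenioid C₀.toElem)
    (hP34 : ∀ A : Dᵒᵖ, ∃ L : PadicFrd.PadicFld.{uK} p, L.IsPadicLocal ∧
      Nonempty (((T.divΛ (C₀.baseOp A)).comp (Units.coeHom (T.BΛ.obj (C₀.baseOp A)))).ker ≃*
        PadicFrd.unitSubgroup L.K)) :
    PreFrobenioid.IsOfUnitProfiniteType C₀.toElem :=
  C₀.isOfUnitProfiniteType_of_ker hF fun A => by
    obtain ⟨L, hL, ⟨e⟩⟩ := hP34 A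
    exact AdmitsTfgProfiniteTopology.of_mulEquiv e.symm
      (PadicFrd.PadicFld.admitsTfgProfiniteTopology_unitSubgroup L hL)

/-- **[EtTh] Thm 3.7 (iv) for `Λ = ℤ` data from Proposition 3.4 (ii)**: "`D` slim ⟹ `C` slim" (L2-t3's
named `Prop` `Thm37_iv`) modulo `hF` and the Prop. 3.4 (ii) isomorphisms `hP34` only — unit-profinite type
gives `⋂ₙ O^×(A)ⁿ = 1` (`Sec3Thm37Units`), then [FrdI] Prop 1.13 (iii). [cite: MochizukiEtTh2009, Thm 3.7 p.80] -/
theorem thm37_iv_of_kerIsoPadicUnits (hF : PreFrobenioid.IsFrobenioid C₀.toElem)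
    (hP34 : ∀ A : Dᵒᵖ, ∃ L : PadicFrd.PadicFld.{uK} p, L.IsPadicLocal ∧
      Nonempty (((T.divΛ (C₀.baseOp A)).comp (Units.coeHom (T.BΛ.obj (C₀.baseOp A)))).ker ≃*
        PadicFrd.unitSubgroup L.K)) :
    C₀.Thm37_iv :=
  C₀.thm37_iv_of_isOfUnitProfiniteType hF (C₀.isOfUnitProfiniteType_of_kerIsoPadicUnits hF hP34)

/-- The slimness conclusion itself for `Λ = ℤ` data, modulo `hF` and `hP34`.
[cite: MochizukiEtTh2009, Thm 3.7 p.80] -/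
theorem isSlim_category_of_kerIsoPadicUnits (hF : PreFrobenioid.IsFrobenioid C₀.toElem)
    (hP34 : ∀ A : Dᵒᵖ, ∃ L : PadicFrd.PadicFld.{uK} p, L.IsPadicLocal ∧
      Nonempty (((T.divΛ (C₀.baseOp A)).comp (Units.coeHom (T.BΛ.obj (C₀.baseOp A)))).ker ≃*
        PadicFrd.unitSubgroup L.K))
    (hD : IsSlim D) : IsSlim C₀.category :=
  C₀.isSlim_category_of_isOfUnitProfiniteType hF (C₀.isOfUnitProfiniteType_of_kerIsoPadicUnits hF hP34) hD

/-- **Both UNIT conjuncts of [EtTh] Thm 3.7 (i) in REAL vocabulary** ("if `Λ = ℤ` (resp. `Λ = ℝ`), then `C`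
is of unit-profinite (resp. unit-trivial) type", with [FrdI] Def 2.8 (i) / Def 1.2 (iv) as L1's real
predicates) for data of monoid type `ℤ`, modulo `hF` and `hP34` (the `Λ = ℝ` conjunct is vacuous).
[cite: MochizukiEtTh2009, Thm 3.7 p.79] -/
theorem thm37_i_unitConjunctsReal_of_kerIsoPadicUnits (hZ : C₀.monoidType = MonoidType.Z)
    (hF : PreFrobenioid.IsFrobenioid C₀.toElem)
    (hP34 : ∀ A : Dᵒᵖ, ∃ L : PadicFrd.PadicFld.{uK} p, L.IsPadicLocal ∧
      Nonempty (((T.divΛ (C₀.baseOp A)).comp (Units.coeHom (T.BΛ.obj (C₀.baseOp A)))).ker ≃*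
        PadicFrd.unitSubgroup L.K)) :
    (C₀.monoidType = MonoidType.Z → PreFrobenioid.IsOfUnitProfiniteType C₀.toElem) ∧
      (C₀.monoidType = MonoidType.R →
        PreFrobenioid.IsOfType (PreFrobenioid.IsUnitTrivial C₀.toElem)) :=
  ⟨fun _ => C₀.isOfUnitProfiniteType_of_kerIsoPadicUnits hF hP34,
    fun h => absurd (hZ.symm.trans h) (by decide)⟩

/-! ### At the canonical [FrdI] vocabulary and for the constructed `Λ = ℤ` data `ofRlfZ` -/

section OfRlfZ

variable {D₀ : Type u₀} [Category.{v₀} D₀] (dm : DivisorMonoids.{u₀, v₀, w} D₀)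
  (hpf : ∀ Y : D₀ᵒᵖ, IsPerfFactorial (dm.Φ₀.obj Y)) {D : Type u} [Category.{v} D]
  {IsRational IsStrictlyRational : (Dᵒᵖ ⥤ CommMonCat.{w}) → Prop}
  (C₁ : TemperedFrobenioid (RealifiedDivisorMonoids.ofRlfZ dm hpf) D
    (treeCatVocab D IsRational IsStrictlyRational)) {p : ℕ} [Fact p.Prime]

/-- For the CONSTRUCTED Def. 3.6 (i) data of monoid type `ℤ` (`B₀^ℤ := B₀`, abc-iut-L6-t12's `ofRlfZ`) at the
canonical vocabulary `treeCatVocab`: **Thm 3.7 (i) "unit-profinite type" and (iv)** modulo L1-t1's residual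
datum `hBmon : IsMonoidOn B` and the Prop. 3.4 (ii) isomorphisms `Ker(B₀(Y_A)^× → (Φ₀^ℝ)^gp) ≅ O_L^×` only.
[cite: MochizukiEtTh2009, Thm 3.7 p.80] -/
theorem thm37_i_unitProfinite_and_iv_ofRlfZ_treeCatVocab (hBmon : IsMonoidOn C₁.ratFnFunctor)
    (hP34 : ∀ A : Dᵒᵖ, ∃ L : PadicFrd.PadicFld.{uK} p, L.IsPadicLocal ∧
      Nonempty ((((RealifiedDivisorMonoids.ofRlfZ dm hpf).divΛ (C₁.baseOp A)).comp
        (Units.coeHom ((RealifiedDivisorMonoids.ofRlfZ dm hpf).BΛ.obj (C₁.baseOp A)))).ker ≃*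
        PadicFrd.unitSubgroup L.K)) :
    PreFrobenioid.IsOfUnitProfiniteType C₁.toElem ∧ C₁.Thm37_iv :=
  ⟨C₁.isOfUnitProfiniteType_of_kerIsoPadicUnits (C₁.isFrobenioid_treeCatVocab_of_isMonoidOn hBmon) hP34,
    C₁.thm37_iv_of_kerIsoPadicUnits (C₁.isFrobenioid_treeCatVocab_of_isMonoidOn hBmon) hP34⟩

end OfRlfZ

end TemperedFrobenioid

end Literature.AnabelianGeometry.EtaleTheta
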